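import Summits.CriticalPhenomena.PercolationContinuityZ3.Theorems.PercNearOneGluingNoHeavyLowerTailSahiCTCRtThreeSlots
import Summits.CriticalPhenomena.PercolationContinuityZ3.Theorems.PercNearOneGluingNoHeavyLowerTailSahiCTCKleitmanPivotCreditsAf
import HarnessLib

/-!
# `NoHeavyLowerTail` (crux stmt-CriticalPhenomena-4575), P3 lane: the squarefree row of `R_3 ∈ ℕ[s]` from a NUMERIC TRANSFER —
# total reserved pairs plus total bad pairs at most total Kleitman surplus (memo g49: (F-ASSIGN) is false, the budget form survives)

Support file (seat `prim-l12-p3`, gen 49; `--supports stmt-CriticalPhenomena-4575`).  Memo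
`run/shared/lean/prim/prim-l12/FROM-prim-l12-p3-g49-PIVOT-BUDGET.md` §1–§2.

The per-edge assignment hypothesis of `coeff_ind_Rt_three_nonneg_of_assignment` (…SahiCTCRtThreeSlotsAssign) is not always satisfiable
(gen 49: an 8-point pair whose three common edges form a triangle).  The bookkeeping behind it is, however, purely numeric: writing
`slots = {U ⊆ V : #U ≤ 2}`, `Cdom` = the common edges among them and `NC = slots ∖ Cdom`,
* **`coeff_ind_Rt_three_nonneg_of_transfer`** : for a loop-free pair of up-sets on `V`, if
  `Σ_{c ∈ Cdom} #res_c + Σ_{U ∈ NC} #bad(V∖U) ≤ Σ_{U ∈ slots} κ(∅, V∖U) + Σ_{c ∈ Cdom} #ext_c`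
  (`res_c` = small common non-members `R ⊆ V∖c` with `V∖(c∪R)` common; `bad(W)` = common edges `c' ⊆ W` with `W∖c'` not common;
  `ext_c` = one-family edges `a ⊆ V∖c` whose co-set lies in the other family only), then `[s^V] R_3(𝒳,𝒵) ≥ 0`;
* **`coeff_ind_Rt_three_nonneg_of_pivotBudget`** : the same with every `κ(∅, V∖U) − #bad(V∖U)`, `U ∈ NC`, replaced by the explicit
  Lemma-A-f credit `#pivotSets(f U; V∖U) − #{bad common edges of V∖U through f U}` for an arbitrary choice of points `f U ∈ V ∖ U`
  (`card_badEdges_avoiding_add_pivotSets_le_kap`, …SahiCTCKleitmanPivotCreditsAf).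
The assignment theorem is the special case in which every unit is paid by a singleton pivot set at its own reserved slot.
Nothing is asserted about the crux; whether the budget hypothesis always holds is open (memo g49 §2: no violation found).
-/

noncomputable section

open scoped Classical

namespace Summit.CriticalPhenomena.PercolationContinuityZ3.Theorems.SahiCTCForms

open Finset MvPolynomial SahiCTCGenFun

variable {α : Type*} [DecidableEq α] [Fintype α]

section Transfer
variable {F G : Finset (Finset α)}

/-- **ROW 0 ⟸ NUMERIC TRANSFER.**  For a loop-free pair on `V`: if the reserved pairs of the common-edge slots plus the bad pairs of all other
slots number at most the total Kleitman surplus of the slots plus the edge-sided crossings of the common-edge slots, then `[s^V] R_3(𝒳,𝒵) ≥ 0`.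
No matching of units to credits is required. [this work] -/
theorem coeff_ind_Rt_three_nonneg_of_transfer (V : Finset α)
    (h0F : ∅ ∉ F) (h1F : ∀ v ∈ V, ({v} : Finset α) ∉ F)
    (hT : (∑ c ∈ ((V.powerset.filter fun U => #U ≤ 2).filter fun U => U ∈ F).filter fun U => U ∈ G,
            (#((V \ c).powerset.filter fun R => #R ≤ 2 ∧ R ∉ F ∧ R ∉ G ∧ (V \ c) \ R ∈ F ∧ (V \ c) \ R ∈ G) : ℤ))
          + ∑ U ∈ (V.powerset.filter fun U => #U ≤ 2).filter fun U => ¬ (U ∈ F ∧ U ∈ G),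
            (#(((V \ U).powerset.filter fun c => #c = 2 ∧ c ∈ F ∧ c ∈ G).filter fun c => ¬ ((V \ U) \ c ∈ F ∧ (V \ U) \ c ∈ G)) : ℤ)
        ≤ (∑ U ∈ V.powerset.filter fun U => #U ≤ 2, kap F G ∅ (V \ U))
          + ∑ c ∈ ((V.powerset.filter fun U => #U ≤ 2).filter fun U => U ∈ F).filter fun U => U ∈ G,
            ((#((V \ c).powerset.filter fun a => #a = 2 ∧ a ∈ F ∧ a ∉ G ∧ (V \ c) \ a ∈ G ∧ (V \ c) \ a ∉ F) : ℤ)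
              + #((V \ c).powerset.filter fun b => #b = 2 ∧ b ∈ G ∧ b ∉ F ∧ (V \ c) \ b ∈ F ∧ (V \ c) \ b ∉ G))) :
    0 ≤ (Rt 3 F G).coeff (ind V) := by
  -- slots and their four types
  set slots := V.powerset.filter fun U => #U ≤ 2 with hslots
  set Cdom := (slots.filter fun U => U ∈ F).filter fun U => U ∈ G with hCdom
  set Adom := (slots.filter fun U => U ∈ F).filter fun U => ¬ U ∈ G with hAdom
  set Bdom := (slots.filter fun U => ¬ U ∈ F).filter fun U => U ∈ G with hBdom
  set Rdom := (slots.filter fun U => ¬ U ∈ F).filter fun U => ¬ U ∈ G with hRdom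
  set NC := slots.filter fun U => ¬ (U ∈ F ∧ U ∈ G) with hNC
  -- the bad common edges of the cube `V \ U`
  set bad : Finset α → Finset (Finset α) := fun U =>
    ((V \ U).powerset.filter fun c => #c = 2 ∧ c ∈ F ∧ c ∈ G).filter fun c => ¬ ((V \ U) \ c ∈ F ∧ (V \ U) \ c ∈ G) with hbad
  have hNCsplit : ∑ U ∈ NC, (#(bad U) : ℤ) = ∑ U ∈ Adom, (#(bad U) : ℤ) + (∑ U ∈ Bdom, (#(bad U) : ℤ) + ∑ U ∈ Rdom, (#(bad U) : ℤ)) := by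
    have h1 : NC.filter (fun U => U ∈ F) = Adom := by
      ext U; simp only [hNC, hAdom, mem_filter]; tauto
    have h2 : NC.filter (fun U => ¬ U ∈ F) = slots.filter fun U => ¬ U ∈ F := by
      ext U; simp only [hNC, mem_filter]; tauto
    rw [← sum_filter_add_sum_filter_not NC (fun U => U ∈ F), h1, h2,
      ← sum_filter_add_sum_filter_not (slots.filter fun U => ¬ U ∈ F) (fun U => U ∈ G)]
  -- the nested small pairs
  set NSP := ((smallN F G) ×ˢ (smallY F G)).filter fun p => Disjoint p.1 p.2 ∧ p.1 ∪ p.2 ⊆ V with hNSP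
  have hmemN : ∀ {S : Finset α}, S ∈ smallN F G ↔ #S < 3 ∧ S ∉ F ∧ S ∉ G := fun {S} => by
    simp only [smallN, bySize, mem_filter, mem_powerset, subset_univ, true_and]
  have hmemY : ∀ {S : Finset α}, S ∈ smallY F G ↔ #S < 3 ∧ S ∈ F ∧ S ∈ G := fun {S} => by
    simp only [smallY, bySize, mem_filter, mem_powerset, subset_univ, true_and]
  have hNSPmem : ∀ {p : Finset α × Finset α}, p ∈ NSP →
      (#p.1 ≤ 2 ∧ p.1 ∉ F ∧ p.1 ∉ G) ∧ (#p.2 = 2 ∧ p.2 ∈ F ∧ p.2 ∈ G) ∧ Disjoint p.1 p.2 ∧ p.1 ⊆ V ∧ p.2 ⊆ V := by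
    intro p hp
    rw [hNSP, mem_filter, mem_product] at hp
    obtain ⟨⟨h1, h2⟩, hd, hu⟩ := hp
    obtain ⟨h1c, h1F', h1G'⟩ := hmemN.1 h1
    obtain ⟨h2c, h2F, h2G⟩ := hmemY.1 h2
    have h2V : p.2 ⊆ V := (subset_union_right).trans hu
    exact ⟨⟨by omega, h1F', h1G'⟩, ⟨card_eq_two_of_mem_of_card_le_two h0F h1F h2F h2V (by omega), h2F, h2G⟩, hd,
      (subset_union_left).trans hu, h2V⟩
  set NSPb := NSP.filter fun p => V \ (p.1 ∪ p.2) ∈ F ∧ V \ (p.1 ∪ p.2) ∈ G with hNSPb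
  set NSPn := NSP.filter fun p => ¬ (V \ (p.1 ∪ p.2) ∈ F ∧ V \ (p.1 ∪ p.2) ∈ G) with hNSPn
  have hNSPsplit : (#NSP : ℤ) = #NSPb + #NSPn := by
    rw [← card_filter_add_card_filter_not (s := NSP) (fun p => V \ (p.1 ∪ p.2) ∈ F ∧ V \ (p.1 ∪ p.2) ∈ G)]; push_cast; rfl
  have hsd : ∀ {R c : Finset α}, Disjoint R c → V \ (R ∪ c) = (V \ c) \ R := fun {R c} _ => by
    ext x; simp only [mem_sdiff, mem_union, not_or]; tauto
  have hsd' : ∀ {R c : Finset α}, Disjoint R c → V \ (R ∪ c) = (V \ R) \ c := fun {R c} _ => by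
    ext x; simp only [mem_sdiff, mem_union, not_or]; tauto
  -- (1) the pairs with non-common co-set inject into the bad edges of the r-slots
  have hNSPn_le : (#NSPn : ℤ) ≤ ∑ R ∈ Rdom, (#(bad R) : ℤ) := by
    have hmaps : Set.MapsTo (fun p : Finset α × Finset α => p.1) (NSPn : Finset (Finset α × Finset α)) (Rdom : Finset (Finset α)) := by
      intro p hp
      obtain ⟨hpN, -⟩ := mem_filter.1 (mem_coe.1 hp)
      obtain ⟨⟨h1c, h1F', h1G'⟩, -, -, h1V, -⟩ := hNSPmem hpN
      exact mem_coe.2 (by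
        rw [hRdom, mem_filter, mem_filter, hslots, mem_filter, mem_powerset]; exact ⟨⟨⟨h1V, h1c⟩, h1F'⟩, h1G'⟩)
    rw [card_eq_sum_card_fiberwise hmaps]
    push_cast
    refine sum_le_sum fun R _ => ?_
    have key : #(NSPn.filter fun p => p.1 = R) ≤ #(bad R) := by
      refine card_le_card_of_injOn (fun p : Finset α × Finset α => p.2) (fun p hp => ?_) (fun p hp p' hp' h => ?_)
      · obtain ⟨hpn, hpR⟩ := mem_filter.1 (mem_coe.1 hp)
        obtain ⟨hpN, hnb⟩ := mem_filter.1 hpn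
        obtain ⟨-, ⟨h2c, h2F, h2G⟩, hd, -, h2V⟩ := hNSPmem hpN
        subst hpR
        refine mem_coe.2 (mem_filter.2 ⟨mem_filter.2 ⟨mem_powerset.2 fun x hx => mem_sdiff.2 ⟨h2V hx, fun h => disjoint_left.1 hd h hx⟩,
          h2c, h2F, h2G⟩, ?_⟩)
        rw [← hsd' hd]; exact hnb
      · obtain ⟨-, hpR⟩ := mem_filter.1 (mem_coe.1 hp)
        obtain ⟨-, hpR'⟩ := mem_filter.1 (mem_coe.1 hp')
        exact Prod.ext (hpR.trans hpR'.symm) h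
    exact_mod_cast key
  -- (2) the pairs with common co-set inject into the reserved sets of the c-slots
  have hNSPb_le : (#NSPb : ℤ) ≤ ∑ c ∈ Cdom,
      (#((V \ c).powerset.filter fun R => #R ≤ 2 ∧ R ∉ F ∧ R ∉ G ∧ (V \ c) \ R ∈ F ∧ (V \ c) \ R ∈ G) : ℤ) := by
    have hmaps : Set.MapsTo (fun p : Finset α × Finset α => p.2) (NSPb : Finset (Finset α × Finset α)) (Cdom : Finset (Finset α)) := by
      intro p hp
      obtain ⟨hpN, -⟩ := mem_filter.1 (mem_coe.1 hp)
      obtain ⟨-, ⟨h2c, h2F, h2G⟩, -, -, h2V⟩ := hNSPmem hpN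
      exact mem_coe.2 (by
        rw [hCdom, mem_filter, mem_filter, hslots, mem_filter, mem_powerset]; exact ⟨⟨⟨h2V, h2c.le⟩, h2F⟩, h2G⟩)
    rw [card_eq_sum_card_fiberwise hmaps]
    push_cast
    refine sum_le_sum fun c _ => ?_
    have key : #(NSPb.filter fun p => p.2 = c) ≤
        #((V \ c).powerset.filter fun R => #R ≤ 2 ∧ R ∉ F ∧ R ∉ G ∧ (V \ c) \ R ∈ F ∧ (V \ c) \ R ∈ G) := by
      refine card_le_card_of_injOn (fun p : Finset α × Finset α => p.1) (fun p hp => ?_) (fun p hp p' hp' h => ?_)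
      · obtain ⟨hpb, hpc⟩ := mem_filter.1 (mem_coe.1 hp)
        obtain ⟨hpN, hb⟩ := mem_filter.1 hpb
        obtain ⟨⟨h1c, h1F', h1G'⟩, -, hd, h1V, -⟩ := hNSPmem hpN
        subst hpc
        refine mem_coe.2 (mem_filter.2 ⟨mem_powerset.2 fun x hx => mem_sdiff.2 ⟨h1V hx, fun h => disjoint_left.1 hd hx h⟩,
          h1c, h1F', h1G', ?_⟩)
        rw [← hsd hd]; exact hb
      · obtain ⟨-, hpc⟩ := mem_filter.1 (mem_coe.1 hp)
        obtain ⟨-, hpc'⟩ := mem_filter.1 (mem_coe.1 hp')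
        exact Prod.ext h (hpc.trans hpc'.symm)
    exact_mod_cast key
  -- (3) the edge-sided crossings of the c-slots inject into the bad edges of the a-/b-slots
  have hext : ∀ (P : Finset α → Prop) (Q : Finset α → Prop) (Edom : Finset (Finset α)),
      (∀ a, a ∈ Edom ↔ a ∈ slots ∧ P a) → (∀ a, P a → a ∈ F ∨ a ∈ G) →
      (∀ S, Q S → ¬ (S ∈ F ∧ S ∈ G)) →
      ∑ c ∈ Cdom, (#((V \ c).powerset.filter fun a => #a = 2 ∧ P a ∧ Q ((V \ c) \ a)) : ℤ) ≤ ∑ a ∈ Edom, (#(bad a) : ℤ) := by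
    intro P Q Edom hE _ hQ
    set PR := (Cdom ×ˢ Edom).filter fun p => Disjoint p.1 p.2 ∧ Q (V \ (p.1 ∪ p.2)) with hPR
    have h1 : ∑ c ∈ Cdom, (#((V \ c).powerset.filter fun a => #a = 2 ∧ P a ∧ Q ((V \ c) \ a)) : ℤ) ≤ #PR := by
      have hmaps : Set.MapsTo (fun p : Finset α × Finset α => p.1) (PR : Finset (Finset α × Finset α)) (Cdom : Finset (Finset α)) :=
        fun p hp => mem_coe.2 (mem_product.1 (mem_filter.1 (mem_coe.1 hp)).1).1
      rw [card_eq_sum_card_fiberwise hmaps]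
      push_cast
      refine sum_le_sum fun c hcC => ?_
      have key : #((V \ c).powerset.filter fun a => #a = 2 ∧ P a ∧ Q ((V \ c) \ a)) ≤ #(PR.filter fun p => p.1 = c) := by
        refine card_le_card_of_injOn (fun a : Finset α => (c, a)) (fun a ha => ?_) (fun a _ a' _ h => (Prod.ext_iff.1 h).2)
        obtain ⟨haV, ha2, hPa, hQa⟩ := mem_filter.1 (mem_coe.1 ha)
        have haV' := mem_powerset.1 haV
        have hd : Disjoint c a := disjoint_left.2 fun x hxc hxa => (mem_sdiff.1 (haV' hxa)).2 hxc
        refine mem_coe.2 (mem_filter.2 ⟨mem_filter.2 ⟨mem_product.2 ⟨hcC, (hE a).2 ⟨?_, hPa⟩⟩, hd, ?_⟩, rfl⟩)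
        · rw [hslots, mem_filter, mem_powerset]; exact ⟨fun x hx => (mem_sdiff.1 (haV' hx)).1, le_of_eq ha2⟩
        · rw [hsd' hd]; exact hQa
      exact_mod_cast key
    have h2 : (#PR : ℤ) ≤ ∑ a ∈ Edom, (#(bad a) : ℤ) := by
      have hmaps : Set.MapsTo (fun p : Finset α × Finset α => p.2) (PR : Finset (Finset α × Finset α)) (Edom : Finset (Finset α)) :=
        fun p hp => mem_coe.2 (mem_product.1 (mem_filter.1 (mem_coe.1 hp)).1).2
      rw [card_eq_sum_card_fiberwise hmaps]
      push_cast
      refine sum_le_sum fun a _ => ?_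
      have key : #(PR.filter fun p => p.2 = a) ≤ #(bad a) := by
       refine card_le_card_of_injOn (fun p : Finset α × Finset α => p.1) (fun p hp => ?_) (fun p hp p' hp' h => ?_)
       · obtain ⟨hpPR, hpa⟩ := mem_filter.1 (mem_coe.1 hp)
         obtain ⟨hcd, hd, hQp⟩ := mem_filter.1 hpPR
         obtain ⟨hcC, -⟩ := mem_product.1 hcd
         subst hpa
         obtain ⟨⟨hcs, hcF⟩, hcG⟩ : (p.1 ∈ slots ∧ p.1 ∈ F) ∧ p.1 ∈ G := by
           rw [hCdom, mem_filter, mem_filter] at hcC; exact hcC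
         obtain ⟨hcV, hc2⟩ := mem_filter.1 hcs
         have hcV' := mem_powerset.1 hcV
         refine mem_coe.2 (mem_filter.2 ⟨mem_filter.2 ⟨mem_powerset.2 fun x hx => mem_sdiff.2 ⟨hcV' hx, fun h => disjoint_left.1 hd hx h⟩,
           card_eq_two_of_mem_of_card_le_two h0F h1F hcF hcV' hc2, hcF, hcG⟩, ?_⟩)
         rw [← hsd hd]; exact hQ _ hQp
       · obtain ⟨-, hpa⟩ := mem_filter.1 (mem_coe.1 hp)
         obtain ⟨-, hpa'⟩ := mem_filter.1 (mem_coe.1 hp')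
         exact Prod.ext h (hpa.trans hpa'.symm)
      exact_mod_cast key
    exact h1.trans h2
  have hext1 : ∑ c ∈ Cdom, (#((V \ c).powerset.filter fun a => #a = 2 ∧ a ∈ F ∧ a ∉ G ∧ (V \ c) \ a ∈ G ∧ (V \ c) \ a ∉ F) : ℤ)
      ≤ ∑ a ∈ Adom, (#(bad a) : ℤ) := by
    have h := hext (fun a => a ∈ F ∧ a ∉ G) (fun S => S ∈ G ∧ S ∉ F) Adom
      (fun a => by rw [hAdom, mem_filter, mem_filter, and_assoc]) (fun a h => Or.inl h.1) (fun S h h' => h.2 h'.1)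
    simpa only [and_assoc] using h
  have hext2 : ∑ c ∈ Cdom, (#((V \ c).powerset.filter fun b => #b = 2 ∧ b ∈ G ∧ b ∉ F ∧ (V \ c) \ b ∈ F ∧ (V \ c) \ b ∉ G) : ℤ)
      ≤ ∑ b ∈ Bdom, (#(bad b) : ℤ) := by
    have h := hext (fun b => b ∈ G ∧ b ∉ F) (fun S => S ∈ F ∧ S ∉ G) Bdom
      (fun b => by rw [hBdom, mem_filter, mem_filter, and_assoc]; tauto) (fun b h => Or.inr h.1) (fun S h h' => h.2 h'.2)
    simpa only [and_assoc] using h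
  -- assemble
  refine coeff_ind_Rt_three_nonneg_of_le F G V ?_
  have hcross : (0 : ℤ) ≤ ∑ S ∈ V.powerset, (pairsAt (smallXo F G) (smallZo F G) (V \ S) : ℤ) :=
    sum_nonneg fun S _ => Nat.cast_nonneg _
  have hnsp : ∑ S ∈ V.powerset, (pairsAt (smallN F G) (smallY F G) (V \ S) : ℤ) = #NSP := sum_pairsAt_eq_card _ _ V
  rw [hnsp, hNSPsplit]
  rw [sum_add_distrib] at hT
  linarith [hNSPn_le, hNSPb_le, hext1, hext2, hcross, hNCsplit]

omit [Fintype α] in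
/-- The bad common edges of a loop-free cube split into those avoiding a point `f` and those through `f`; with Lemma A-f
(`card_badEdges_avoiding_add_pivotSets_le_kap`): `#bad(W) + (#pivotSets(f; W) − #bad edges through f) ≤ κ(∅, W)`. [this work] -/
theorem card_bad_add_pivot_sub_badAt_le_kap (hF : IsUpperSet (F : Set (Finset α))) (hG : IsUpperSet (G : Set (Finset α)))
    (W : Finset α) (f : α) (hf : f ∈ W) (h1F : ∀ v ∈ W, ({v} : Finset α) ∉ F) (h1G : ∀ v ∈ W, ({v} : Finset α) ∉ G) :
    (#(((W.powerset.filter fun c => #c = 2 ∧ c ∈ F ∧ c ∈ G).filter fun c => ¬ (W \ c ∈ F ∧ W \ c ∈ G))) : ℤ)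
      + (#((W.erase f).powerset.filter fun T => T ∉ F ∧ T ∉ G ∧ insert f T ∈ F ∧ insert f T ∈ G)
        - #(((W.powerset.filter fun c => #c = 2 ∧ c ∈ F ∧ c ∈ G).filter fun c => ¬ (W \ c ∈ F ∧ W \ c ∈ G)).filter fun c => f ∈ c))
      ≤ kap F G ∅ W := by
  have hLX : ∀ u ∈ W, insert u (∅ : Finset α) ∉ F := fun u hu => by rw [insert_empty]; exact h1F u hu
  have hLZ : ∀ u ∈ W, insert u (∅ : Finset α) ∉ G := fun u hu => by rw [insert_empty]; exact h1G u hu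
  have hAf := card_badEdges_avoiding_add_pivotSets_le_kap hF hG (#W) W ∅ f le_rfl (disjoint_empty_left _) hf hLX hLZ
  simp only [empty_union] at hAf
  have hsplit := card_filter_add_card_filter_not
    (s := (W.powerset.filter fun c => #c = 2 ∧ c ∈ F ∧ c ∈ G).filter fun c => ¬ (W \ c ∈ F ∧ W \ c ∈ G)) (fun c => f ∈ c)
  have hcast : (#(((W.powerset.filter fun c => #c = 2 ∧ c ∈ F ∧ c ∈ G).filter fun c => ¬ (W \ c ∈ F ∧ W \ c ∈ G))) : ℤ)
      = #((((W.powerset.filter fun c => #c = 2 ∧ c ∈ F ∧ c ∈ G).filter fun c => ¬ (W \ c ∈ F ∧ W \ c ∈ G))).filter fun c => f ∈ c)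
        + #((((W.powerset.filter fun c => #c = 2 ∧ c ∈ F ∧ c ∈ G).filter fun c => ¬ (W \ c ∈ F ∧ W \ c ∈ G))).filter
            fun c => ¬ f ∈ c) := by
    rw [← hsplit]; push_cast; rfl
  linarith

/-- **ROW 0 ⟸ PIVOT BUDGET.**  For a loop-free pair of up-sets on `V` and ANY choice of points `f U ∈ V ∖ U` at the slots `U` that are not
common edges: if the reserved pairs of the common-edge slots plus the bad common edges through the chosen points number at most the Kleitman
surpluses of the common-edge slots, plus their edge-sided crossings, plus the pivot sets of the chosen points, then `[s^V] R_3(𝒳,𝒵) ≥ 0`.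
This contains `coeff_ind_Rt_three_nonneg_of_assignment` (every vote there is a singleton pivot set) and needs no matching. [this work] -/
theorem coeff_ind_Rt_three_nonneg_of_pivotBudget (hF : IsUpperSet (F : Set (Finset α))) (hG : IsUpperSet (G : Set (Finset α)))
    (V : Finset α) (h0F : ∅ ∉ F) (h1F : ∀ v ∈ V, ({v} : Finset α) ∉ F) (h1G : ∀ v ∈ V, ({v} : Finset α) ∉ G) (f : Finset α → α)
    (hf : ∀ U ∈ (V.powerset.filter fun U => #U ≤ 2).filter fun U => ¬ (U ∈ F ∧ U ∈ G), f U ∈ V \ U)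
    (hB : (∑ c ∈ ((V.powerset.filter fun U => #U ≤ 2).filter fun U => U ∈ F).filter fun U => U ∈ G,
            (#((V \ c).powerset.filter fun R => #R ≤ 2 ∧ R ∉ F ∧ R ∉ G ∧ (V \ c) \ R ∈ F ∧ (V \ c) \ R ∈ G) : ℤ))
          + ∑ U ∈ (V.powerset.filter fun U => #U ≤ 2).filter fun U => ¬ (U ∈ F ∧ U ∈ G),
            (#((((V \ U).powerset.filter fun c => #c = 2 ∧ c ∈ F ∧ c ∈ G).filter
                fun c => ¬ ((V \ U) \ c ∈ F ∧ (V \ U) \ c ∈ G)).filter fun c => f U ∈ c) : ℤ)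
        ≤ (∑ c ∈ ((V.powerset.filter fun U => #U ≤ 2).filter fun U => U ∈ F).filter fun U => U ∈ G, kap F G ∅ (V \ c))
          + (∑ c ∈ ((V.powerset.filter fun U => #U ≤ 2).filter fun U => U ∈ F).filter fun U => U ∈ G,
            ((#((V \ c).powerset.filter fun a => #a = 2 ∧ a ∈ F ∧ a ∉ G ∧ (V \ c) \ a ∈ G ∧ (V \ c) \ a ∉ F) : ℤ)
              + #((V \ c).powerset.filter fun b => #b = 2 ∧ b ∈ G ∧ b ∉ F ∧ (V \ c) \ b ∈ F ∧ (V \ c) \ b ∉ G)))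
          + ∑ U ∈ (V.powerset.filter fun U => #U ≤ 2).filter fun U => ¬ (U ∈ F ∧ U ∈ G),
            (#(((V \ U).erase (f U)).powerset.filter fun T => T ∉ F ∧ T ∉ G ∧ insert (f U) T ∈ F ∧ insert (f U) T ∈ G) : ℤ)) :
    0 ≤ (Rt 3 F G).coeff (ind V) := by
  set slots := V.powerset.filter fun U => #U ≤ 2 with hslots
  set Cdom := (slots.filter fun U => U ∈ F).filter fun U => U ∈ G with hCdom
  set NC := slots.filter fun U => ¬ (U ∈ F ∧ U ∈ G) with hNC
  -- per non-c slot: bad + (pivots − bad through f) ≤ kap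
  have hslot : ∀ U ∈ NC,
      (#((((V \ U).powerset.filter fun c => #c = 2 ∧ c ∈ F ∧ c ∈ G).filter fun c => ¬ ((V \ U) \ c ∈ F ∧ (V \ U) \ c ∈ G))) : ℤ)
        + (#(((V \ U).erase (f U)).powerset.filter fun T => T ∉ F ∧ T ∉ G ∧ insert (f U) T ∈ F ∧ insert (f U) T ∈ G)
          - #((((V \ U).powerset.filter fun c => #c = 2 ∧ c ∈ F ∧ c ∈ G).filter
              fun c => ¬ ((V \ U) \ c ∈ F ∧ (V \ U) \ c ∈ G)).filter fun c => f U ∈ c))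
        ≤ kap F G ∅ (V \ U) := fun U hU =>
    card_bad_add_pivot_sub_badAt_le_kap hF hG (V \ U) (f U) (hf U hU)
      (fun v hv => h1F v (mem_sdiff.1 hv).1) (fun v hv => h1G v (mem_sdiff.1 hv).1)
  have hsum := sum_le_sum hslot
  rw [sum_add_distrib, sum_sub_distrib] at hsum
  have hkap : ∑ U ∈ slots, kap F G ∅ (V \ U) = ∑ c ∈ Cdom, kap F G ∅ (V \ c) + ∑ U ∈ NC, kap F G ∅ (V \ U) := by
    have h1 : slots.filter (fun U => U ∈ F ∧ U ∈ G) = Cdom := by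
      ext U; simp only [hCdom, mem_filter]; tauto
    rw [← sum_filter_add_sum_filter_not slots (fun U => U ∈ F ∧ U ∈ G), h1]
  refine coeff_ind_Rt_three_nonneg_of_transfer V h0F h1F ?_
  rw [hkap]
  linarith

end Transfer

end Summit.CriticalPhenomena.PercolationContinuityZ3.Theorems.SahiCTCForms
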